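import Mathlib
import Summits.AtomisticToContinuum.FouriersLaw.Theses.EmbeddedDrudeMourre
import Summits.AtomisticToContinuum.FouriersLaw.Theorems.EmbeddedDrudeMourreDrudeDissolutionStubFreeOddExcursionKernelFGR
import Summits.AtomisticToContinuum.FouriersLaw.Theorems.EmbeddedDrudeMourreDrudeDissolutionStubFreeOddExcursionKernelAbelWindow
import HarnessLib

/-!
# Stub B2 `stub_excursionIntegralFGR` of line `kinetic-polymer-gas-on-the-time-axis`
(crux `EmbeddedDrudeMourre.DrudeDissolution`, item stmt-AtomisticToContinuum-12593; `--supports` file, closes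
nothing; lead c13, 2026-08-17)

WHAT. The registered stub B2 of the crux's skeleton
(`Cruxes/DrudeDissolution/Lines/kinetic_polymer_gas_on_the_time_axis.lean`, v3): for `ω₂ > 0`, couplings `a, b`,
a `2π`-periodic `C²` profile `f`, and any `F : ℝ → ℝ` which is the cosine transform of the bracket-weighted
two-phonon density of states `m_f = Ω_*(W dk)` (`F(t) = ∫ cos(t x) dm_f(x)` for every `t`) and which is integrable
on `(0,∞)`: `∫₀^∞ F = (64π²/9)·q_{ω₂,a,b}(f)` — the Fermi-golden-rule identity of the line (`q = boltzmannForm`).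

HOW. By the LANDED `freeOddExcursionKernel_eq_cosTransform` (lead c11, p140460), `F` coincides pointwise with the
free odd excursion kernel `F_f` written as a box integral over `(−π,π]³`; the identity is then the LANDED
`integral_freeOddExcursionKernel_of_integrableOn` (lead c11, p140313: Abel summation for integrable functions,
Fubini, and the threshold Fermi golden rule `fermiGoldenRule_threshold` of the sibling crux stmt-12594).
-/

noncomputable section

open MeasureTheory Filter Set Function Topology Real
open scoped ENNReal NNReal Topology
open Literature.MathematicalPhysics.KineticTheory
open Literature.MathematicalPhysics.KineticTheory.PhononBoltzmann

namespace Summit.AtomisticToContinuum.FouriersLaw.Theorems.DrudeDissolution.KineticPolymerGasOnTheTimeAxis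

/-- **Stub B2 `stub_excursionIntegralFGR` (registered signature, verbatim).** For `ω₂ > 0`, couplings `a, b`,
a `2π`-periodic `C²` profile `f` and any `F ∈ L¹(0,∞)` with `F(t) = ∫ cos(t x) dm_f(x)` for all `t`
(`m_f = Ω_*(W dk)` the bracket-weighted two-phonon density of states of the sibling crux):
`∫₀^∞ F = (64π²/9)·(boltzmannForm ω₂ a b f).toReal`.
[cite: AokiLukkarinenSpohn2006, eqs. (3.17)-(3.20), (4.10)-(4.11), (4.16)] -/
theorem stub_excursionIntegralFGR :
    ∀ ω₂ a b : ℝ, 0 < ω₂ → ∀ f : ℝ → ℝ, Function.Periodic f (2 * Real.pi) → ContDiff ℝ 2 f →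
      ∀ F : ℝ → ℝ,
        (∀ t : ℝ, F t = ∫ x, Real.cos (t * x) ∂(MeasureTheory.Measure.map (fun p : ℝ × ℝ × ℝ => resonanceFn ω₂ p.1 p.2.2 p.2.1)
            (((volume.restrict (Set.Ioc (-Real.pi) Real.pi)).prod
                ((volume.restrict (Set.Ioc (-Real.pi) Real.pi)).prod
                  (volume.restrict (Set.Ioc (-Real.pi) Real.pi)))).withDensity
              (fun p : ℝ × ℝ × ℝ => ENNReal.ofReal
                (vertex a b p.1 p.2.2 p.2.1 ^ 2 /
                    (dispersion ω₂ p.1 * dispersion ω₂ p.2.2 * dispersion ω₂ p.2.1 *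
                      dispersion ω₂ (p.1 + p.2.2 - p.2.1)) ^ 2 *
                  (f p.1 + f p.2.2 - f p.2.1 - f (p.1 + p.2.2 - p.2.1)) ^ 2))))) →
        MeasureTheory.IntegrableOn F (Set.Ioi 0) →
        ∫ t in Set.Ioi (0 : ℝ), F t = (64 * π ^ 2 / 9) * (boltzmannForm ω₂ a b f).toReal := by
  intro ω₂ a b hω f hper hf F hF hint
  -- `F` is, pointwise, the free odd excursion kernel written as a box integral over the cell
  have hFeq : F = fun t : ℝ => ∫ k in Set.pi Set.univ (fun _ : Fin 3 => Set.Ioc (-Real.pi) Real.pi),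
      vertex a b (k 0) (k 1) (k 2) ^ 2 *
        (f (k 0) + f (k 1) - f (k 2) - f (k 0 + k 1 - k 2)) ^ 2 /
        (dispersion ω₂ (k 0) * dispersion ω₂ (k 1) * dispersion ω₂ (k 2) *
          dispersion ω₂ (k 0 + k 1 - k 2)) ^ 2 *
        Real.cos (t * resonanceFn ω₂ (k 0) (k 1) (k 2)) := by
    funext t
    rw [hF t, freeOddExcursionKernel_eq_cosTransform ω₂ a b hω f hf.continuous t]
    refine integral_congr_ae (ae_of_all _ (fun x => ?_))
    show Real.cos (t * x) = Real.cos (x * t)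
    rw [mul_comm t x]
  subst hFeq
  exact integral_freeOddExcursionKernel_of_integrableOn ω₂ a b hω f hper hf hint

end Summit.AtomisticToContinuum.FouriersLaw.Theorems.DrudeDissolution.KineticPolymerGasOnTheTimeAxis

end
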